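import Literature.NumberTheory.EllipticCurves.ZpExtensionEisensteinTwistDualPerfect
import HarnessLib

/-!
# The tail-form readout of the `θ`-twisted invariants of `H ⊗ A_{m,k}`: `Inv_θ(A_{m,k} ⊗ H) ≅ ker((θ − 1)^m + p)`

Topic `NumberTheory/EllipticCurves` (sequel to `ZpExtensionEisensteinTwistDual`, `ZpExtensionEisensteinTwistDualPerfect`,
`IwasawaAlgebraEisensteinQuotientDuality`; cell `pub/bsd-print-x9`, the DISCRETE control of the shared μ-crux
`MuInequalityCoherentPair(OfHoward)`, road R1′ at Howard's Eisenstein primes `q_m = T^m + p`).  Definitions with bodies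
(`CoeffExtension.mapEnd`, `CoeffExtension.readout`, `CoeffExtension.twistedInvariants`) and theorems; no named fact,
no instance, no notation, no `sorry`.

THE ALGEBRA UNDER THE DISCRETE COMPARISON `H¹(K, A_q[p^k]) → H¹(K_∞, E[p^k])[ψ_m]`.  Let `A = A_{m,k} = Λ/(T^m + p, p^k)`
(free over `ℤ/p^k` on `[T^i]`, `i < m`, with `[T]^m = -p`), `H` an abelian group killed by `p^k` (in the port:
`H¹(K_∞, E[p^k])`) and `θ : H → H` additive (in the port: the conjugation `conj_γ` by a topological generator `γ` of
`Gal(K_∞/K)`).  A class of `H¹(K, E[p^k] ⊗ A(ψ⁻¹))` restricts to an element `y` of `A ⊗ H` fixed by the DIAGONAL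
action `conj_γ ⊗ ψ⁻¹(γ)`, i.e. satisfying `(1 ⊗ θ) y = (1 + T) • y` — the **`θ`-twisted invariants**
`Inv_θ(A ⊗ H)`.  This file proves the module-theoretic identity behind Howard's «`H¹(K, A_q) ≅ H¹(K, 𝐀)[q]`»
(Lemma 2.2.7 / Prop. 2.2.8, the discrete half of the control at `q`), read through the tail form
`λ_k : A → ℤ/p^k` of `IwasawaAlgebraEisensteinQuotientDuality`:

* `readout λ_k : A ⊗ H → H`, `c ⊗ h ↦ λ_k(c) · h`, sends `∑_i [T^i] ⊗ w_i ↦ w_{m-1}` and the `[π_j^*]`-translates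
  read ALL coordinates (`readout_dualFamily_smul_sum`); on `Inv_θ` the coordinates satisfy
  `(θ − 1) w_j = w_{j−1}` (`j ≥ 1`) and `(θ − 1) w_0 = −p · w_{m−1}` (`sub_one_apply_coord_of_mem`), whence
  **`w_j = (θ − 1)^{m−1−j} w_{m−1}` and `((θ − 1)^m + p) w_{m−1} = 0`**;
* conversely `h ↦ y_h := ∑_i [T^i] ⊗ (θ − 1)^{m−1−i} h` lands in `Inv_θ` when `((θ − 1)^m + p) h = 0`;
* so **`readout λ_k` restricts to a BIJECTION `Inv_θ(A ⊗ H) → ker((θ − 1)^m + p)`**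
  (`readout_injOn_twistedInvariants`, `readout_mem_ker_of_mem_twistedInvariants`,
  `exists_mem_twistedInvariants_readout_eq`) — with `θ = conj_γ` the target is exactly `ker ψ_m`,
  `ψ_m = (conj_γ − 1)^m + p`, the subgroup of `Sel_{p^∞}(E/K_∞)` Pontryagin-dual to `𝒳/q_m 𝒳`
  (`WeierstrassCurve.SelmerDualData.exists_linearMap_quotSMulTop_qm_characterModule`).

References: [Howard2004HeegnerKolyvagin] B. Howard, *The Heegner point Kolyvagin system*, Compositio Math. 140 (2004),
Lemma 2.2.7, Prop. 2.2.8 and proof of Thm. 2.2.10 («taking `𝔮 = T^m + p`»); [GreenbergLNM1716] R. Greenberg, LNM 1716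
(1999), §4 p. 98 («`X/θ_n X` is the Pontryagin dual of `Sel^{Γ_n}`») and p. 107 («`H¹(F_∞, A_s) = H¹(F_∞, E[p^∞]) ⊗ κ^s`»);
[Washington1997] §13.2; [DeSmitRubinSchoof1997] Cor. 2.2 (dual basis of a monogenic algebra).  BSD is not proved by any of this.
-/

noncomputable section

open scoped TensorProduct
open Function

universe v w

namespace Literature.NumberTheory.EllipticCurves

open Literature.NumberTheory.GaloisRepresentations Literature.RingTheory.CompleteIntersection

/-! ## §1 Generic coefficient rings: `1 ⊗ θ`, the `λ`-readout, the twisted invariants -/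

section Generic

variable {𝒪 : Type v} [CommRing 𝒪] {H : Type w} [AddCommGroup H]

/-- `(f - g) s = f s - g s` in `AddMonoid.End` (plumbing, `rfl`). [cite: Washington1997, §13.2] -/
private theorem twistedReadout_end_sub_apply (f g : AddMonoid.End H) (s : H) : (f - g) s = f s - g s := rfl

/-- `(f + g) s = f s + g s` in `AddMonoid.End` (plumbing, `rfl`). [cite: Washington1997, §13.2] -/
private theorem twistedReadout_end_add_apply (f g : AddMonoid.End H) (s : H) : (f + g) s = f s + g s := rfl

/-- `(f * g) s = f (g s)` in `AddMonoid.End` (plumbing, `rfl`). [cite: Washington1997, §13.2] -/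
private theorem twistedReadout_end_mul_apply (f g : AddMonoid.End H) (s : H) : (f * g) s = f (g s) := rfl

/-- **`1 ⊗ θ` on `𝒪 ⊗ H`** for an additive `θ : H → H` (Mathlib `LinearMap.baseChange`), `𝒪`-linear.
[cite: GreenbergLNM1716, §4 p. 107 (the action of Γ on H¹(F_∞, A_s) = H¹(F_∞, E[p^∞]) ⊗ κ^s)] -/
def CoeffExtension.mapEnd (θ : AddMonoid.End H) : CoeffExtension ℤ 𝒪 H →ₗ[𝒪] CoeffExtension ℤ 𝒪 H :=
  ((AddMonoidHom.toIntLinearMap θ).baseChange 𝒪 : 𝒪 ⊗[ℤ] H →ₗ[𝒪] 𝒪 ⊗[ℤ] H)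

/-- Unfolding on pure tensors: `(1 ⊗ θ)(c ⊗ h) = c ⊗ θ h`. [cite: GreenbergLNM1716, §4 p. 107] -/
@[simp]
theorem CoeffExtension.mapEnd_tmul (θ : AddMonoid.End H) (c : 𝒪) (h : H) :
    CoeffExtension.mapEnd θ (CoeffExtension.tmul c h : CoeffExtension ℤ 𝒪 H) = CoeffExtension.tmul c (θ h) :=
  LinearMap.baseChange_tmul _ _ _

variable {n : ℕ} [NeZero n] (lam : 𝒪 →+ ZMod n) (hH : ∀ h : H, n • h = 0)

/-- **The `λ`-readout `𝒪 ⊗ H → H`, `c ⊗ h ↦ λ(c) · h`** (`H` killed by `n`, `λ : 𝒪 → ℤ/n` additive; the tree's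
`coeffContract`). [cite: Howard2004HeegnerKolyvagin, §2.1 (the map 𝒟_𝔭 → ℚ_p/ℤ_p)] -/
def CoeffExtension.readout : CoeffExtension ℤ 𝒪 H →+ H :=
  ((coeffContract lam hH : 𝒪 ⊗[ℤ] H →ₗ[ℤ] H).toAddMonoidHom : 𝒪 ⊗[ℤ] H →+ H)

/-- Unfolding on pure tensors: `readout (c ⊗ h) = (λ c).val • h`. [cite: Howard2004HeegnerKolyvagin, §2.1] -/
@[simp]
theorem CoeffExtension.readout_tmul (c : 𝒪) (h : H) :
    CoeffExtension.readout lam hH (CoeffExtension.tmul c h : CoeffExtension ℤ 𝒪 H) = (lam c).val • h :=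
  coeffContract_tmul lam hH c h

/-- The readout in the additive currency `ZMod.nsmulHom`: `readout (c ⊗ h) = nsmulHom (λ c) h`.
[cite: Howard2004HeegnerKolyvagin, §2.1] -/
theorem CoeffExtension.readout_tmul_eq_nsmulHom (c : 𝒪) (h : H) :
    CoeffExtension.readout lam hH (CoeffExtension.tmul c h : CoeffExtension ℤ 𝒪 H) = ZMod.nsmulHom hH (lam c) h :=
  coeffContract_tmul lam hH c h

/-- **The readout commutes with `1 ⊗ θ`**: `readout ((1 ⊗ θ) y) = θ (readout y)`. [cite: GreenbergLNM1716, §4 p. 107] -/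
theorem CoeffExtension.readout_mapEnd (θ : AddMonoid.End H) (y : CoeffExtension ℤ 𝒪 H) :
    CoeffExtension.readout lam hH (CoeffExtension.mapEnd θ y) = θ (CoeffExtension.readout lam hH y) := by
  induction y using CoeffExtension.induction_on with
  | zero => rw [map_zero, map_zero, map_zero]
  | tmul c h => rw [CoeffExtension.mapEnd_tmul, CoeffExtension.readout_tmul, CoeffExtension.readout_tmul, map_nsmul]
  | add x y hx hy => rw [map_add, map_add, map_add, map_add, hx, hy]

/-- The same after a scalar: `readout (c • (1 ⊗ θ) y) = θ (readout (c • y))` (`1 ⊗ θ` is `𝒪`-linear).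
[cite: GreenbergLNM1716, §4 p. 107] -/
theorem CoeffExtension.readout_smul_mapEnd (θ : AddMonoid.End H) (c : 𝒪) (y : CoeffExtension ℤ 𝒪 H) :
    CoeffExtension.readout lam hH (c • CoeffExtension.mapEnd θ y) =
      θ (CoeffExtension.readout lam hH (c • y)) := by
  rw [← map_smul, CoeffExtension.readout_mapEnd]

/-- **The `θ`-twisted invariants `Inv_θ^u(𝒪 ⊗ H) = {y | (1 ⊗ θ) y = u • y}`** — for `u = ψ(γ)` the subgroup of
`𝒪 ⊗ H¹(K_∞, M)` cut out by the diagonal action of `γ` on `H¹(K_∞, M ⊗ 𝒪(ψ⁻¹))`.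
[cite: GreenbergLNM1716, §4 p. 107 (H¹(F_∞, A_s) = H¹(F_∞, E[p^∞]) ⊗ κ^s as Γ-modules)] -/
def CoeffExtension.twistedInvariants (u : 𝒪) (θ : AddMonoid.End H) : AddSubgroup (CoeffExtension ℤ 𝒪 H) :=
  (CoeffExtension.mapEnd θ - u • LinearMap.id : CoeffExtension ℤ 𝒪 H →ₗ[𝒪] CoeffExtension ℤ 𝒪 H).toAddMonoidHom.ker

/-- Membership: `y ∈ Inv_θ^u ↔ (1 ⊗ θ) y = u • y`. [cite: GreenbergLNM1716, §4 p. 107] -/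
theorem CoeffExtension.mem_twistedInvariants_iff (u : 𝒪) (θ : AddMonoid.End H) (y : CoeffExtension ℤ 𝒪 H) :
    y ∈ CoeffExtension.twistedInvariants u θ ↔ CoeffExtension.mapEnd θ y = u • y := by
  rw [CoeffExtension.twistedInvariants, AddMonoidHom.mem_ker, LinearMap.toAddMonoidHom_coe, LinearMap.sub_apply,
    LinearMap.smul_apply, LinearMap.id_apply, sub_eq_zero]

end Generic

/-! ## §2 `A_{m,k}`: coordinates read by the tail form -/

namespace IwasawaAlgebra

variable (p : ℕ) [hp : Fact p.Prime] {m : ℕ} (hm : 1 ≤ m) (k : ℕ) {H : Type w} [AddCommGroup H]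
  (hH : ∀ h : H, (p ^ k) • h = 0)

/-- In `A_{m,k}`: `[T^m] = -p` (`q_m = T^m + p ↦ 0`). [cite: Howard2004HeegnerKolyvagin, proof of Thm. 2.2.10 (𝔮 = T^m + p)] -/
theorem EisensteinCoeff.mk_X_pow_eq_neg_natCast :
    (Ideal.Quotient.mk _ ((PowerSeries.X : IwasawaAlgebra p) ^ m) : EisensteinCoeff p m k) = -(p : EisensteinCoeff p m k) := by
  rw [eq_neg_iff_add_eq_zero]
  have hC : (PowerSeries.C (p : ℤ_[p]) : IwasawaAlgebra p) = (p : IwasawaAlgebra p) := map_natCast _ p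
  have h : (Ideal.Quotient.mk (Ideal.span {(PowerSeries.X ^ m + PowerSeries.C (p : ℤ_[p]) : IwasawaAlgebra p)} ⊔
      Ideal.span {PowerSeries.C ((p : ℤ_[p]) ^ k)})) (PowerSeries.X ^ m + PowerSeries.C (p : ℤ_[p])) = 0 :=
    Ideal.Quotient.eq_zero_iff_mem.mpr (Ideal.mem_sup_left (Ideal.mem_span_singleton_self _))
  have hp' : (Ideal.Quotient.mk (Ideal.span {(PowerSeries.X ^ m + PowerSeries.C (p : ℤ_[p]) : IwasawaAlgebra p)} ⊔
      Ideal.span {PowerSeries.C ((p : ℤ_[p]) ^ k)})) (PowerSeries.C (p : ℤ_[p])) = (p : EisensteinCoeff p m k) := by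
    rw [congrArg (Ideal.Quotient.mk (Ideal.span {(PowerSeries.X ^ m + PowerSeries.C (p : ℤ_[p]) : IwasawaAlgebra p)} ⊔
      Ideal.span {PowerSeries.C ((p : ℤ_[p]) ^ k)})) hC]
    exact map_natCast _ p
  rw [map_add, hp'] at h
  exact h

/-- `λ_k([T^i]) = δ_{i,m-1}` for `i < m`. [cite: DeSmitRubinSchoof1997, Prop. 2.1 (case n = 1)] [cite: Howard2004HeegnerKolyvagin, §2.1] -/
theorem EisensteinCoeff.tailFormZMod_mk_X_pow (i : Fin m) :
    EisensteinCoeff.tailFormZMod p hm k (Ideal.Quotient.mk _ ((PowerSeries.X : IwasawaAlgebra p) ^ (i : ℕ))) =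
      if (i : ℕ) = m - 1 then 1 else 0 := by
  rw [EisensteinCoeff.tailFormZMod_mk, tailForm_mk_X_pow p hm i.2]
  split_ifs
  · rw [map_one]
  · rw [map_zero]

/-- **`λ_k([π_j^*] · [T^{i+1}])`** for `i, j < m`: `1` if `i + 1 = j`, `-p` if `i = m - 1` and `j = 0` (since `[T^m] = -p`),
`0` otherwise. [cite: DeSmitRubinSchoof1997, Cor. 2.2 (case n = 1)] [cite: Howard2004HeegnerKolyvagin, §2.1 and §2.2] -/
theorem EisensteinCoeff.tailFormZMod_dualFamily_mul_mk_X_pow_succ (i j : Fin m) :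
    EisensteinCoeff.tailFormZMod p hm k (EisensteinCoeff.dualFamily p hm k j *
        Ideal.Quotient.mk _ ((PowerSeries.X : IwasawaAlgebra p) ^ ((i : ℕ) + 1))) =
      if (i : ℕ) + 1 = j then 1 else if (i : ℕ) + 1 = m ∧ (j : ℕ) = 0 then -(p : ZMod (p ^ k)) else 0 := by
  by_cases hi : (i : ℕ) + 1 < m
  · have h := EisensteinCoeff.tailFormZMod_dualFamily_mul_mk_X_pow p hm k j ⟨(i : ℕ) + 1, hi⟩
    rw [h]
    by_cases hij : (i : ℕ) + 1 = j
    · rw [if_pos (Fin.ext hij), if_pos hij]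
    · rw [if_neg (fun h' => hij (congrArg Fin.val h')), if_neg hij, if_neg (fun h' => absurd h'.1 (ne_of_lt hi))]
  · have him : (i : ℕ) + 1 = m := le_antisymm i.2 (not_lt.mp hi)
    have hj : (i : ℕ) + 1 ≠ j := fun h => absurd j.2 (by rw [← h, him]; exact lt_irrefl _)
    rw [if_neg hj, him, EisensteinCoeff.mk_X_pow_eq_neg_natCast p k, mul_neg, map_neg, ← nsmul_eq_mul', map_nsmul]
    have h0 := EisensteinCoeff.tailFormZMod_dualFamily_mul_mk_X_pow p hm k j ⟨0, lt_of_lt_of_le zero_lt_one hm⟩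
    simp only [pow_zero, map_one, mul_one] at h0
    rw [h0]
    by_cases hj0 : (j : ℕ) = 0
    · rw [if_pos (Fin.ext hj0.symm), if_pos ⟨rfl, hj0⟩, nsmul_eq_mul, mul_one]
    · rw [if_neg (fun h' => hj0 (congrArg Fin.val h').symm), if_neg (fun h' => hj0 h'.2), smul_zero, neg_zero]

/-- The readout by the tail form `λ_k` on `A_{m,k} ⊗ H` (abbreviation of the generic `readout`).
[cite: Howard2004HeegnerKolyvagin, §2.1 (the map 𝒟_𝔭 → ℚ_p/ℤ_p) and §2.2] -/
abbrev EisensteinCoeff.Twisted.tailReadout : EisensteinCoeff.Twisted p m k H →+ H :=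
  CoeffExtension.readout (EisensteinCoeff.tailFormZMod p hm k).toAddMonoidHom hH

/-- **The tail readout of `∑_i [T^i] ⊗ w_i` is the top coordinate `w_{m-1}`.**
[cite: Howard2004HeegnerKolyvagin, §2.1 and §2.2] [cite: Washington1997, §13.2] -/
theorem EisensteinCoeff.Twisted.tailReadout_sum (w : Fin m → H) :
    EisensteinCoeff.Twisted.tailReadout p hm k hH (∑ i : Fin m, EisensteinCoeff.Twisted.tmul
        (Ideal.Quotient.mk _ ((PowerSeries.X : IwasawaAlgebra p) ^ (i : ℕ)) : EisensteinCoeff p m k) (w i)) =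
      w ⟨m - 1, Nat.sub_lt (lt_of_lt_of_le zero_lt_one hm) zero_lt_one⟩ := by
  rw [map_sum, Finset.sum_eq_single ⟨m - 1, Nat.sub_lt (lt_of_lt_of_le zero_lt_one hm) zero_lt_one⟩]
  · rw [CoeffExtension.readout_tmul_eq_nsmulHom, LinearMap.toAddMonoidHom_coe,
      EisensteinCoeff.tailFormZMod_mk_X_pow, if_pos rfl]
    exact ZMod.nsmulHom_one_apply hH _
  · intro i _ hi
    rw [CoeffExtension.readout_tmul_eq_nsmulHom, LinearMap.toAddMonoidHom_coe,
      EisensteinCoeff.tailFormZMod_mk_X_pow, if_neg (fun h => hi (Fin.ext h)), map_zero, AddMonoidHom.zero_apply]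
  · intro h; exact absurd (Finset.mem_univ _) h

/-- **Coordinate readout**: `λ_k`-reading the `[π_j^*]`-translate of `∑_i [T^i] ⊗ w_i` gives `w_j`.
[cite: DeSmitRubinSchoof1997, Cor. 2.2 (case n = 1)] [cite: Howard2004HeegnerKolyvagin, §2.1 and §2.2] -/
theorem EisensteinCoeff.Twisted.tailReadout_dualFamily_smul_sum (w : Fin m → H) (j : Fin m) :
    EisensteinCoeff.Twisted.tailReadout p hm k hH (EisensteinCoeff.dualFamily p hm k j •
      ∑ i : Fin m, EisensteinCoeff.Twisted.tmul
        (Ideal.Quotient.mk _ ((PowerSeries.X : IwasawaAlgebra p) ^ (i : ℕ)) : EisensteinCoeff p m k) (w i)) = w j := by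
  rw [Finset.smul_sum, map_sum, Finset.sum_eq_single j]
  · rw [EisensteinCoeff.Twisted.smul_tmul, CoeffExtension.readout_tmul_eq_nsmulHom, LinearMap.toAddMonoidHom_coe,
      EisensteinCoeff.tailFormZMod_dualFamily_mul_mk_X_pow, if_pos rfl]
    exact ZMod.nsmulHom_one_apply hH _
  · intro i _ hi
    rw [EisensteinCoeff.Twisted.smul_tmul, CoeffExtension.readout_tmul_eq_nsmulHom, LinearMap.toAddMonoidHom_coe,
      EisensteinCoeff.tailFormZMod_dualFamily_mul_mk_X_pow, if_neg hi, map_zero, AddMonoidHom.zero_apply]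
  · intro h; exact absurd (Finset.mem_univ _) h

/-- **Every element is the sum of its read coordinates**: `y = ∑_i [T^i] ⊗ λ_k([π_i^*] • y)`.
[cite: DeSmitRubinSchoof1997, Cor. 2.2 (case n = 1)] [cite: Howard2004HeegnerKolyvagin, §2.2] -/
theorem EisensteinCoeff.Twisted.eq_sum_tmul_tailReadout (y : EisensteinCoeff.Twisted p m k H) :
    y = ∑ i : Fin m, EisensteinCoeff.Twisted.tmul
      (Ideal.Quotient.mk _ ((PowerSeries.X : IwasawaAlgebra p) ^ (i : ℕ)) : EisensteinCoeff p m k)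
      (EisensteinCoeff.Twisted.tailReadout p hm k hH (EisensteinCoeff.dualFamily p hm k i • y)) := by
  obtain ⟨w, rfl⟩ := EisensteinCoeff.exists_eq_sum_tmul_mk_X_pow_of_padicInt p hm y
  exact Finset.sum_congr rfl fun i _ => by rw [EisensteinCoeff.Twisted.tailReadout_dualFamily_smul_sum]

/-- Hence an element all of whose read coordinates vanish is zero. [cite: DeSmitRubinSchoof1997, Cor. 2.2 (case n = 1)] -/
theorem EisensteinCoeff.Twisted.eq_zero_of_forall_tailReadout_dualFamily_smul_eq_zero (y : EisensteinCoeff.Twisted p m k H)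
    (hy : ∀ j : Fin m, EisensteinCoeff.Twisted.tailReadout p hm k hH (EisensteinCoeff.dualFamily p hm k j • y) = 0) :
    y = 0 := by
  rw [EisensteinCoeff.Twisted.eq_sum_tmul_tailReadout p hm k hH y]
  exact Finset.sum_eq_zero fun i _ => by rw [hy i, EisensteinCoeff.Twisted.tmul_zero]

/-- **Multiplication by `[T]` on coordinates, read by `λ_k`**: for `y = ∑_i [T^i] ⊗ w_i`,
`λ_k([π_j^*] • [T] • y) = w_{j-1}` for `j ≥ 1` and `= -(p · w_{m-1})` for `j = 0` (`[T^m] = -p`).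
[cite: Howard2004HeegnerKolyvagin, proof of Thm. 2.2.10 (𝔮 = T^m + p)] [cite: Washington1997, §13.2] -/
theorem EisensteinCoeff.Twisted.tailReadout_dualFamily_smul_X_smul_sum (w : Fin m → H) (j : Fin m) :
    EisensteinCoeff.Twisted.tailReadout p hm k hH (EisensteinCoeff.dualFamily p hm k j •
      (Ideal.Quotient.mk _ (PowerSeries.X : IwasawaAlgebra p) : EisensteinCoeff p m k) •
        ∑ i : Fin m, EisensteinCoeff.Twisted.tmul
          (Ideal.Quotient.mk _ ((PowerSeries.X : IwasawaAlgebra p) ^ (i : ℕ)) : EisensteinCoeff p m k) (w i)) =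
      if (j : ℕ) = 0 then -(p • w ⟨m - 1, Nat.sub_lt (lt_of_lt_of_le zero_lt_one hm) zero_lt_one⟩)
      else w ⟨(j : ℕ) - 1, lt_of_le_of_lt (Nat.sub_le _ _) j.2⟩ := by
  -- expand: `[π_j^*] • [T] • ∑ [T^i] ⊗ w_i = ∑ ([π_j^*][T^{i+1}]) ⊗ w_i`, then read
  have hterm : ∀ i : Fin m, EisensteinCoeff.Twisted.tailReadout p hm k hH (EisensteinCoeff.dualFamily p hm k j •
      (Ideal.Quotient.mk _ (PowerSeries.X : IwasawaAlgebra p) : EisensteinCoeff p m k) •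
        EisensteinCoeff.Twisted.tmul (Ideal.Quotient.mk _ ((PowerSeries.X : IwasawaAlgebra p) ^ (i : ℕ)) : EisensteinCoeff p m k)
          (w i)) =
      ZMod.nsmulHom hH (if (i : ℕ) + 1 = j then 1 else if (i : ℕ) + 1 = m ∧ (j : ℕ) = 0 then -(p : ZMod (p ^ k)) else 0)
        (w i) := fun i => by
    rw [EisensteinCoeff.Twisted.smul_tmul, EisensteinCoeff.Twisted.smul_tmul, ← map_mul, ← pow_succ',
      CoeffExtension.readout_tmul_eq_nsmulHom, LinearMap.toAddMonoidHom_coe,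
      EisensteinCoeff.tailFormZMod_dualFamily_mul_mk_X_pow_succ]
  rw [Finset.smul_sum, Finset.smul_sum, map_sum]
  simp_rw [hterm]
  by_cases hj : (j : ℕ) = 0
  · rw [if_pos hj, Finset.sum_eq_single ⟨m - 1, Nat.sub_lt (lt_of_lt_of_le zero_lt_one hm) zero_lt_one⟩]
    · have h1 : ¬ (((⟨m - 1, Nat.sub_lt (lt_of_lt_of_le zero_lt_one hm) zero_lt_one⟩ : Fin m) : ℕ) + 1 = j) := by
        rw [hj]; exact Nat.succ_ne_zero _
      have h2 : ((⟨m - 1, Nat.sub_lt (lt_of_lt_of_le zero_lt_one hm) zero_lt_one⟩ : Fin m) : ℕ) + 1 = m ∧ (j : ℕ) = 0 :=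
        ⟨Nat.sub_add_cancel hm, hj⟩
      rw [if_neg h1, if_pos h2, map_neg, AddMonoidHom.neg_apply, ZMod.nsmulHom_apply_apply, ZMod.val_natCast,
        nsmul_mod_eq_nsmul_of_nsmul_eq_zero hH]
    · intro i _ hi
      have h1 : ¬ ((i : ℕ) + 1 = j) := by rw [hj]; exact Nat.succ_ne_zero _
      have h2 : ¬ ((i : ℕ) + 1 = m ∧ (j : ℕ) = 0) := fun h => hi (Fin.ext (by
        have := h.1; show (i : ℕ) = m - 1; omega))
      rw [if_neg h1, if_neg h2, map_zero, AddMonoidHom.zero_apply]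
    · intro h; exact absurd (Finset.mem_univ _) h
  · rw [if_neg hj, Finset.sum_eq_single ⟨(j : ℕ) - 1, lt_of_le_of_lt (Nat.sub_le _ _) j.2⟩]
    · have h1 : ((⟨(j : ℕ) - 1, lt_of_le_of_lt (Nat.sub_le _ _) j.2⟩ : Fin m) : ℕ) + 1 = j := by
        show (j : ℕ) - 1 + 1 = j; omega
      rw [if_pos h1]
      exact ZMod.nsmulHom_one_apply hH _
    · intro i _ hi
      have h1 : ¬ ((i : ℕ) + 1 = j) := fun h => hi (Fin.ext (by show (i : ℕ) = (j : ℕ) - 1; omega))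
      have h2 : ¬ ((i : ℕ) + 1 = m ∧ (j : ℕ) = 0) := fun h => hj h.2
      rw [if_neg h1, if_neg h2, map_zero, AddMonoidHom.zero_apply]
    · intro h; exact absurd (Finset.mem_univ _) h

/-! ## §3 The twisted invariants of `A_{m,k} ⊗ H`: recursion of coordinates, readout bijective onto `ker((θ-1)^m + p)` -/

variable (θ : AddMonoid.End H)

/-- **The coordinate recursion on `Inv_θ`**: if `(1 ⊗ θ) y = (1 + T) • y` then, with `w_j = λ_k([π_j^*] • y)`,
`(θ − 1) w_j = w_{j−1}` for `j ≥ 1` and `(θ − 1) w_0 = −(p · w_{m−1})`.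
[cite: GreenbergLNM1716, §4 p. 107] [cite: Howard2004HeegnerKolyvagin, proof of Thm. 2.2.10 (𝔮 = T^m + p)] -/
theorem EisensteinCoeff.Twisted.sub_one_apply_coord_of_mem {y : EisensteinCoeff.Twisted p m k H}
    (hy : y ∈ CoeffExtension.twistedInvariants (EisensteinCoeff.onePlusT p m k) θ) (j : Fin m) :
    (θ - 1) (EisensteinCoeff.Twisted.tailReadout p hm k hH (EisensteinCoeff.dualFamily p hm k j • y)) =
      if (j : ℕ) = 0 then
        -(p • EisensteinCoeff.Twisted.tailReadout p hm k hH (EisensteinCoeff.dualFamily p hm k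
          ⟨m - 1, Nat.sub_lt (lt_of_lt_of_le zero_lt_one hm) zero_lt_one⟩ • y))
      else EisensteinCoeff.Twisted.tailReadout p hm k hH (EisensteinCoeff.dualFamily p hm k
          ⟨(j : ℕ) - 1, lt_of_le_of_lt (Nat.sub_le _ _) j.2⟩ • y) := by
  rw [CoeffExtension.mem_twistedInvariants_iff] at hy
  -- `θ w_j = λ_k([π_j^*] • (1 ⊗ θ) y) = λ_k([π_j^*] • (1+T) • y) = w_j + λ_k([π_j^*] • [T] • y)`
  have h1 := CoeffExtension.readout_smul_mapEnd (EisensteinCoeff.tailFormZMod p hm k).toAddMonoidHom hH θ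
    (EisensteinCoeff.dualFamily p hm k j) y
  rw [hy, EisensteinCoeff.onePlusT_def, map_add, map_one, add_smul, one_smul, smul_add, map_add] at h1
  -- `h1 : w_j + λ_k([π_j^*] • [T] • y) = θ w_j`
  rw [twistedReadout_end_sub_apply, AddMonoid.End.one_apply, ← h1, add_sub_cancel_left]
  -- read `[T] • y` in coordinates
  have hyw := EisensteinCoeff.Twisted.eq_sum_tmul_tailReadout p hm k hH y
  conv_lhs => rw [hyw]
  exact EisensteinCoeff.Twisted.tailReadout_dualFamily_smul_X_smul_sum p hm k hH _ j

/-- **`w_{m-1-d} = (θ − 1)^d w_{m−1}` on `Inv_θ`** (`d < m`), by the recursion.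
[cite: GreenbergLNM1716, §4 p. 107] [cite: Howard2004HeegnerKolyvagin, proof of Thm. 2.2.10] -/
theorem EisensteinCoeff.Twisted.coord_eq_pow_apply_of_mem {y : EisensteinCoeff.Twisted p m k H}
    (hy : y ∈ CoeffExtension.twistedInvariants (EisensteinCoeff.onePlusT p m k) θ) {d : ℕ} (hd : d < m) :
    EisensteinCoeff.Twisted.tailReadout p hm k hH (EisensteinCoeff.dualFamily p hm k
        ⟨m - 1 - d, lt_of_le_of_lt (Nat.sub_le _ _) (Nat.sub_lt (lt_of_lt_of_le zero_lt_one hm) zero_lt_one)⟩ • y) =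
      ((θ - 1) ^ d) (EisensteinCoeff.Twisted.tailReadout p hm k hH (EisensteinCoeff.dualFamily p hm k
        ⟨m - 1, Nat.sub_lt (lt_of_lt_of_le zero_lt_one hm) zero_lt_one⟩ • y)) := by
  induction d with
  | zero => simp only [Nat.sub_zero, pow_zero, AddMonoid.End.one_apply]
  | succ d ih =>
    have hd' : d < m := Nat.lt_of_succ_lt hd
    rw [pow_succ', twistedReadout_end_mul_apply, ← ih hd', EisensteinCoeff.Twisted.sub_one_apply_coord_of_mem p hm k hH θ hy]
    have hne : ¬ (((⟨m - 1 - d, lt_of_le_of_lt (Nat.sub_le _ _)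
        (Nat.sub_lt (lt_of_lt_of_le zero_lt_one hm) zero_lt_one)⟩ : Fin m) : ℕ) = 0) := by
      show ¬ (m - 1 - d = 0); omega
    rw [if_neg hne]
    have hidx : (⟨m - 1 - (d + 1), lt_of_le_of_lt (Nat.sub_le _ _)
        (Nat.sub_lt (lt_of_lt_of_le zero_lt_one hm) zero_lt_one)⟩ : Fin m) =
        ⟨((⟨m - 1 - d, lt_of_le_of_lt (Nat.sub_le _ _) (Nat.sub_lt (lt_of_lt_of_le zero_lt_one hm) zero_lt_one)⟩ :
          Fin m) : ℕ) - 1, lt_of_le_of_lt (Nat.sub_le _ _) (lt_of_le_of_lt (Nat.sub_le _ _)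
            (Nat.sub_lt (lt_of_lt_of_le zero_lt_one hm) zero_lt_one))⟩ :=
      Fin.ext (by show m - 1 - (d + 1) = m - 1 - d - 1; omega)
    rw [hidx]

/-- **The readout of a twisted invariant is killed by `(θ − 1)^m + p`.**
[cite: Howard2004HeegnerKolyvagin, Lemma 2.2.7 / Prop. 2.2.8 (H¹(K, A_q) → H¹(K, 𝐀)[q]) and proof of Thm. 2.2.10 (𝔮 = T^m + p)]
[cite: GreenbergLNM1716, §4 p. 98 and p. 107] -/
theorem EisensteinCoeff.Twisted.tailReadout_mem_ker_of_mem {y : EisensteinCoeff.Twisted p m k H}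
    (hy : y ∈ CoeffExtension.twistedInvariants (EisensteinCoeff.onePlusT p m k) θ) :
    ((θ - 1) ^ m + (p : AddMonoid.End H)) (EisensteinCoeff.Twisted.tailReadout p hm k hH y) = 0 := by
  -- `readout y = w_{m-1}` (read `y` in coordinates), `(θ-1)^{m-1} w_{m-1} = w_0`, `(θ-1) w_0 = -p w_{m-1}`
  have hread : EisensteinCoeff.Twisted.tailReadout p hm k hH y =
      EisensteinCoeff.Twisted.tailReadout p hm k hH (EisensteinCoeff.dualFamily p hm k
        ⟨m - 1, Nat.sub_lt (lt_of_lt_of_le zero_lt_one hm) zero_lt_one⟩ • y) := by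
    conv_lhs => rw [EisensteinCoeff.Twisted.eq_sum_tmul_tailReadout p hm k hH y]
    rw [EisensteinCoeff.Twisted.tailReadout_sum]
  have h0 := EisensteinCoeff.Twisted.coord_eq_pow_apply_of_mem p hm k hH θ hy (d := m - 1)
    (Nat.sub_lt (lt_of_lt_of_le zero_lt_one hm) zero_lt_one)
  have hidx : (⟨m - 1 - (m - 1), lt_of_le_of_lt (Nat.sub_le _ _)
      (Nat.sub_lt (lt_of_lt_of_le zero_lt_one hm) zero_lt_one)⟩ : Fin m) = ⟨0, lt_of_lt_of_le zero_lt_one hm⟩ :=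
    Fin.ext (by show m - 1 - (m - 1) = 0; omega)
  rw [hidx] at h0
  have hrec := EisensteinCoeff.Twisted.sub_one_apply_coord_of_mem p hm k hH θ hy ⟨0, lt_of_lt_of_le zero_lt_one hm⟩
  rw [if_pos rfl, h0] at hrec
  have hpow : (θ - 1) ^ m = (θ - 1) * (θ - 1) ^ (m - 1) := by
    rw [← pow_succ', Nat.sub_add_cancel hm]
  rw [twistedReadout_end_add_apply, AddMonoid.End.natCast_apply, hread, hpow, twistedReadout_end_mul_apply, hrec, neg_add_cancel]

/-- **Injectivity of the readout on the twisted invariants.**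
[cite: Howard2004HeegnerKolyvagin, Lemma 2.2.7 / Prop. 2.2.8] [cite: GreenbergLNM1716, §4 p. 107] -/
theorem EisensteinCoeff.Twisted.tailReadout_injOn_twistedInvariants :
    Set.InjOn (EisensteinCoeff.Twisted.tailReadout p hm k hH)
      (CoeffExtension.twistedInvariants (EisensteinCoeff.onePlusT p m k) θ : Set (EisensteinCoeff.Twisted p m k H)) := by
  -- additive map: it suffices that the kernel on the subgroup is trivial
  intro y hy y' hy' hyy'
  rw [← sub_eq_zero]
  have hmem : y - y' ∈ CoeffExtension.twistedInvariants (EisensteinCoeff.onePlusT p m k) θ := sub_mem hy hy'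
  have hzero : EisensteinCoeff.Twisted.tailReadout p hm k hH (y - y') = 0 := by rw [map_sub, hyy', sub_self]
  -- all coordinates vanish: `w_{m-1-d} = (θ-1)^d w_{m-1}` and `w_{m-1} = readout = 0`
  refine EisensteinCoeff.Twisted.eq_zero_of_forall_tailReadout_dualFamily_smul_eq_zero p hm k hH _ fun j => ?_
  have htop : EisensteinCoeff.Twisted.tailReadout p hm k hH (EisensteinCoeff.dualFamily p hm k
      ⟨m - 1, Nat.sub_lt (lt_of_lt_of_le zero_lt_one hm) zero_lt_one⟩ • (y - y')) = 0 := by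
    rw [← hzero]
    conv_rhs => rw [EisensteinCoeff.Twisted.eq_sum_tmul_tailReadout p hm k hH (y - y')]
    rw [EisensteinCoeff.Twisted.tailReadout_sum]
  have hd : m - 1 - (j : ℕ) < m := lt_of_le_of_lt (Nat.sub_le _ _) (Nat.sub_lt (lt_of_lt_of_le zero_lt_one hm) zero_lt_one)
  have h := EisensteinCoeff.Twisted.coord_eq_pow_apply_of_mem p hm k hH θ hmem hd
  have hjj : (⟨m - 1 - (m - 1 - (j : ℕ)), lt_of_le_of_lt (Nat.sub_le _ _)
      (Nat.sub_lt (lt_of_lt_of_le zero_lt_one hm) zero_lt_one)⟩ : Fin m) = j :=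
    Fin.ext (by have := j.2; show m - 1 - (m - 1 - (j : ℕ)) = (j : ℕ); omega)
  rw [hjj] at h
  rw [h, htop, map_zero]

variable (m) in
/-- **The candidate preimage** `y_h = ∑_i [T^i] ⊗ (θ − 1)^{m−1−i} h`. [cite: Howard2004HeegnerKolyvagin, proof of Thm. 2.2.10 (𝔮 = T^m + p)] -/
def EisensteinCoeff.Twisted.invariantLift (h : H) : EisensteinCoeff.Twisted p m k H :=
  ∑ i : Fin m, EisensteinCoeff.Twisted.tmul
    (Ideal.Quotient.mk _ ((PowerSeries.X : IwasawaAlgebra p) ^ (i : ℕ)) : EisensteinCoeff p m k)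
    (((θ - 1) ^ (m - 1 - (i : ℕ))) h)

/-- Its readout is `h`. [cite: Howard2004HeegnerKolyvagin, proof of Thm. 2.2.10] -/
theorem EisensteinCoeff.Twisted.tailReadout_invariantLift (h : H) :
    EisensteinCoeff.Twisted.tailReadout p hm k hH (EisensteinCoeff.Twisted.invariantLift p m k θ h) = h := by
  rw [EisensteinCoeff.Twisted.invariantLift, EisensteinCoeff.Twisted.tailReadout_sum]
  simp only [Nat.sub_self, pow_zero, AddMonoid.End.one_apply]

include hm hH in
/-- **`y_h` is a twisted invariant when `((θ − 1)^m + p) h = 0`.**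
[cite: Howard2004HeegnerKolyvagin, Lemma 2.2.7 / Prop. 2.2.8 and proof of Thm. 2.2.10 (𝔮 = T^m + p)] [cite: GreenbergLNM1716, §4 p. 107] -/
theorem EisensteinCoeff.Twisted.invariantLift_mem (h : H) (hh : ((θ - 1) ^ m + (p : AddMonoid.End H)) h = 0) :
    EisensteinCoeff.Twisted.invariantLift p m k θ h ∈
      CoeffExtension.twistedInvariants (EisensteinCoeff.onePlusT p m k) θ := by
  rw [CoeffExtension.mem_twistedInvariants_iff, ← sub_eq_zero]
  refine EisensteinCoeff.Twisted.eq_zero_of_forall_tailReadout_dualFamily_smul_eq_zero p hm k hH _ fun j => ?_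
  have h1 := CoeffExtension.readout_smul_mapEnd (EisensteinCoeff.tailFormZMod p hm k).toAddMonoidHom hH θ
    (EisensteinCoeff.dualFamily p hm k j) (EisensteinCoeff.Twisted.invariantLift p m k θ h)
  rw [smul_sub, map_sub, h1, EisensteinCoeff.onePlusT_def, map_add, map_one, add_smul, one_smul, smul_add, map_add,
    EisensteinCoeff.Twisted.invariantLift, EisensteinCoeff.Twisted.tailReadout_dualFamily_smul_sum,
    EisensteinCoeff.Twisted.tailReadout_dualFamily_smul_X_smul_sum]
  -- `θ v_j - (v_j + shift_j) = 0` with `v_j = (θ-1)^{m-1-j} h`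
  have hθv : θ (((θ - 1) ^ (m - 1 - (j : ℕ))) h) - ((θ - 1) ^ (m - 1 - (j : ℕ))) h =
      ((θ - 1) ^ (m - 1 - (j : ℕ) + 1)) h := by
    rw [pow_succ', twistedReadout_end_mul_apply, twistedReadout_end_sub_apply, AddMonoid.End.one_apply]
  rw [sub_add_eq_sub_sub, hθv]
  by_cases hj : (j : ℕ) = 0
  · rw [if_pos hj, hj, Nat.sub_zero, Nat.sub_add_cancel hm, sub_neg_eq_add]
    have htop : m - 1 - ((⟨m - 1, Nat.sub_lt (lt_of_lt_of_le zero_lt_one hm) zero_lt_one⟩ : Fin m) : ℕ) = 0 := by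
      rw [Fin.val_mk, Nat.sub_self]
    rw [htop, pow_zero, AddMonoid.End.one_apply]
    rw [twistedReadout_end_add_apply, AddMonoid.End.natCast_apply] at hh
    exact hh
  · rw [if_neg hj, sub_eq_zero]
    show ((θ - 1) ^ (m - 1 - (j : ℕ) + 1)) h = ((θ - 1) ^ (m - 1 - ((j : ℕ) - 1))) h
    have hidx : m - 1 - (j : ℕ) + 1 = m - 1 - ((j : ℕ) - 1) := by have := j.2; omega
    rw [hidx]

include hm hH in
/-- **Surjectivity onto `ker((θ − 1)^m + p)`**: every `h` with `((θ − 1)^m + p) h = 0` is the readout of a twisted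
invariant. [cite: Howard2004HeegnerKolyvagin, Lemma 2.2.7 / Prop. 2.2.8 and proof of Thm. 2.2.10 (𝔮 = T^m + p)]
[cite: GreenbergLNM1716, §4 p. 98 and p. 107] -/
theorem EisensteinCoeff.Twisted.exists_mem_twistedInvariants_tailReadout_eq (h : H)
    (hh : ((θ - 1) ^ m + (p : AddMonoid.End H)) h = 0) :
    ∃ y ∈ CoeffExtension.twistedInvariants (EisensteinCoeff.onePlusT p m k) θ,
      EisensteinCoeff.Twisted.tailReadout p hm k hH y = h :=
  ⟨EisensteinCoeff.Twisted.invariantLift p m k θ h, EisensteinCoeff.Twisted.invariantLift_mem p hm k hH θ h hh,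
    EisensteinCoeff.Twisted.tailReadout_invariantLift p hm k hH θ h⟩

/-- **SUMMARY — the readout is a bijection `Inv_θ(A_{m,k} ⊗ H) → ker((θ − 1)^m + p)`** (as a map of subtypes).  With
`H = H¹(K_∞, E[p^k])`, `θ = conj_γ`: the level-`k` algebra of `H¹(K, A_q[p^k]) ≅ H¹(K_∞, E[p^k])[ψ_m]`,
`ψ_m = (conj_γ − 1)^m + p`, the discrete half of Howard's control at `q_m = T^m + p`.
[cite: Howard2004HeegnerKolyvagin, Lemma 2.2.7 / Prop. 2.2.8 and proof of Thm. 2.2.10 (𝔮 = T^m + p)]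
[cite: GreenbergLNM1716, §4 p. 98 and p. 107] -/
theorem EisensteinCoeff.Twisted.bijective_tailReadout_restrict :
    Bijective (Set.MapsTo.restrict (EisensteinCoeff.Twisted.tailReadout p hm k hH)
      (CoeffExtension.twistedInvariants (EisensteinCoeff.onePlusT p m k) θ : Set (EisensteinCoeff.Twisted p m k H))
      {h : H | ((θ - 1) ^ m + (p : AddMonoid.End H)) h = 0}
      (fun _ hy => EisensteinCoeff.Twisted.tailReadout_mem_ker_of_mem p hm k hH θ hy)) := by
  constructor
  · rintro ⟨y, hy⟩ ⟨y', hy'⟩ hyy'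
    exact Subtype.ext (EisensteinCoeff.Twisted.tailReadout_injOn_twistedInvariants p hm k hH θ hy hy'
      (congrArg Subtype.val hyy'))
  · rintro ⟨h, hh⟩
    obtain ⟨y, hy, hyh⟩ := EisensteinCoeff.Twisted.exists_mem_twistedInvariants_tailReadout_eq p hm k hH θ h hh
    exact ⟨⟨y, hy⟩, Subtype.ext hyh⟩

end IwasawaAlgebra

end Literature.NumberTheory.EllipticCurves
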